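import Summits.AtomisticToContinuum.Crystallization.Theses.ExcessDecayLiouville

/-!
# `HcpLiouville` / Negative: the matching and admissibility hypotheses are load-bearing

Negative knowledge for crux `stmt-AtomisticToContinuum-9332`
(`ExcessDecayLiouville.HcpLiouville`, route `ExcessDecayLiouville`, rank 3), crux-disprover seat
(2026-08-16). `HcpLiouville` is definitionally `PhononStability → Core`, where `Core` is the coarse
Liouville statement: every `δ`-separated Lennard-Jones force-balanced `X ⊂ ℝ³` that is globally two-way
`1/40`-matched with an admissible affine hcp two-lattice datum `(t, A)` (`‖A − 0.97 R‖ ≤ 1/40`, hcp-like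
inner displacement) is exactly a two-lattice `{t'_m + A' z}` with `A'` admissible.

This file certifies, with explicit degenerate witnesses, that two of the hypotheses of `Core` cannot be
dropped (any proof must use them):

* `hcpLiouvilleCore_false_without_matching` — without the global matching `∀ c r, Near X c r t A (1/40)`
  the EMPTY configuration (vacuously separated and force-balanced) would have to be a two-lattice,
  but every `{t'_m + A' z}` contains `t' 0`;
* `hcpLiouvilleCore_false_without_adm` — without `Adm A` on the REFERENCE cell, the degenerate datum
  `A = 0`, `t = (0, 0)` collapses the reference two-lattice to the single site `0`; the one-particle
  configuration `{0}` is separated, force-balanced (empty force family) and globally matched to it, yet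
  it is not `{t'_m + A' z}` for an admissible `A'`, because that set contains the two distinct points
  `t' 0` and `t' 0 + A'(2√(2/3) e₃)` (`‖A' v‖ ≥ (0.97 − 1/40)‖v‖`).

The statements are the crux's own `let`-abbreviations with one hypothesis deleted (and the
`PhononStability` antecedent removed: a refuter cannot discharge it, and with it in place nothing is
refutable). Nothing here closes an item; the separation hypothesis `Sep X δ` is NOT load-bearing (it is
implied by the others, see the crux work file `Cruxes/HcpLiouville/Disproof.lean`).
-/

noncomputable section

namespace Summit.AtomisticToContinuum.Crystallization.Theorems

open Literature.MathematicalPhysics.StatisticalMechanics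

/-- **The global matching hypothesis of `HcpLiouville` is load-bearing.** The crux's `Core` with
`∀ c r, Near X c r t A (1/40)` deleted is false: witness `X = ∅`, `δ = 1`, `A = 0.97 · id`
(admissible with `R = id`), `t = (0, A(w + √(2/3)e₃))` (inner displacement exactly hcp); the conclusion
fails since `t' 0 = t' 0 + A' 0 ∈ {t'_m + A' z : z ∈ Λ} ≠ ∅`. [folklore] -/
theorem hcpLiouvilleCore_false_without_matching :
    ¬ (let Λ : Set (EuclideanSpace ℝ (Fin 3)) := {z | ∃ i j k : ℤ, z = (i : ℝ) • triangularVec₁ 1 +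
          (j : ℝ) • triangularVec₂ 1 + (k : ℝ) • layerNormal (2 * Real.sqrt (2 / 3))}
       let Adm : (EuclideanSpace ℝ (Fin 3) →L[ℝ] EuclideanSpace ℝ (Fin 3)) → Prop := fun A =>
          ∃ R : EuclideanSpace ℝ (Fin 3) ≃ₗᵢ[ℝ] EuclideanSpace ℝ (Fin 3),
            ‖A - (97 / 100 : ℝ) • (R.toContinuousLinearEquiv :
              EuclideanSpace ℝ (Fin 3) →L[ℝ] EuclideanSpace ℝ (Fin 3))‖ ≤ 1 / 40
       let Inner : (Fin 2 → EuclideanSpace ℝ (Fin 3)) →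
          (EuclideanSpace ℝ (Fin 3) →L[ℝ] EuclideanSpace ℝ (Fin 3)) → Prop := fun t A =>
          ‖t 1 - t 0 - A (barlowOffset 1 + layerNormal (Real.sqrt (2 / 3)))‖ ≤ 1 / 40
       let Sites : (Fin 2 → EuclideanSpace ℝ (Fin 3)) →
          (EuclideanSpace ℝ (Fin 3) →L[ℝ] EuclideanSpace ℝ (Fin 3)) → Set (EuclideanSpace ℝ (Fin 3)) :=
          fun t A => {p | ∃ m : Fin 2, ∃ z ∈ Λ, p = t m + A z}
       let Sep : Set (EuclideanSpace ℝ (Fin 3)) → ℝ → Prop := fun X δ =>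
          ∀ p ∈ X, ∀ q ∈ X, p ≠ q → δ ≤ dist p q
       let Equil : Set (EuclideanSpace ℝ (Fin 3)) → Prop := fun X => ∀ p ∈ X,
          HasSum (fun q : {q : EuclideanSpace ℝ (Fin 3) // q ∈ X ∧ q ≠ p} =>
            (deriv lennardJones (dist p q.1) / dist p q.1) • (p - q.1)) 0
       ∀ δ : ℝ, 0 < δ → ∀ X : Set (EuclideanSpace ℝ (Fin 3)), Sep X δ → Equil X →
         ∀ (t : Fin 2 → EuclideanSpace ℝ (Fin 3))
           (A : EuclideanSpace ℝ (Fin 3) →L[ℝ] EuclideanSpace ℝ (Fin 3)), Adm A → Inner t A →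
           ∃ (t' : Fin 2 → EuclideanSpace ℝ (Fin 3))
             (A' : EuclideanSpace ℝ (Fin 3) →L[ℝ] EuclideanSpace ℝ (Fin 3)), Adm A' ∧ X = Sites t' A') := by
  intro h
  let A : EuclideanSpace ℝ (Fin 3) →L[ℝ] EuclideanSpace ℝ (Fin 3) :=
    (97 / 100 : ℝ) • ContinuousLinearMap.id ℝ (EuclideanSpace ℝ (Fin 3))
  have hAdm : ∃ R : EuclideanSpace ℝ (Fin 3) ≃ₗᵢ[ℝ] EuclideanSpace ℝ (Fin 3),
      ‖A - (97 / 100 : ℝ) • (R.toContinuousLinearEquiv :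
        EuclideanSpace ℝ (Fin 3) →L[ℝ] EuclideanSpace ℝ (Fin 3))‖ ≤ 1 / 40 := by
    refine ⟨LinearIsometryEquiv.refl ℝ (EuclideanSpace ℝ (Fin 3)), ?_⟩
    have h0 : A - (97 / 100 : ℝ) • ((LinearIsometryEquiv.refl ℝ (EuclideanSpace ℝ (Fin 3)))
        |>.toContinuousLinearEquiv : EuclideanSpace ℝ (Fin 3) →L[ℝ] EuclideanSpace ℝ (Fin 3)) = 0 := by
      apply ContinuousLinearMap.ext
      intro x
      simp [A]
    rw [h0, norm_zero]
    norm_num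
  let t : Fin 2 → EuclideanSpace ℝ (Fin 3) :=
    ![0, A (barlowOffset 1 + layerNormal (Real.sqrt (2 / 3)))]
  have hInner : ‖t 1 - t 0 - A (barlowOffset 1 + layerNormal (Real.sqrt (2 / 3)))‖ ≤ 1 / 40 := by
    simp only [t, Matrix.cons_val_one, Matrix.cons_val_zero, Matrix.cons_val_fin_one,
      sub_zero, sub_self, norm_zero]
    norm_num
  obtain ⟨t', A', -, hX⟩ := h 1 one_pos ∅ (by simp) (by simp) t A hAdm hInner
  have hmem : t' 0 + A' 0 ∈ (∅ : Set (EuclideanSpace ℝ (Fin 3))) := by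
    rw [hX]
    exact ⟨0, 0, ⟨0, 0, 0, by simp⟩, rfl⟩
  exact hmem

/-- **The admissibility hypothesis `Adm A` of `HcpLiouville` (on the reference cell) is
load-bearing.** The crux's `Core` with `Adm A` deleted is false: witness `A = 0`, `t = (0, 0)` (the
reference set is `{0}`), `X = {0}`, `δ = 1`; `X` is separated, force-balanced (the force family is
indexed by the empty type) and globally two-way `1/40`-matched, but `X = {t'_m + A' z}` with `A'`
admissible is impossible: `t' 0 = 0` and `t' 0 + A' c = 0` for `c = 2√(2/3) e₃ ∈ Λ ∖ 0` give `A' c = 0`,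
while `‖(A' − 0.97 R) c‖ ≤ ‖c‖/40` forces `‖A' c‖ ≥ 0.97‖c‖ − ‖c‖/40 > 0`. [folklore] -/
theorem hcpLiouvilleCore_false_without_adm :
    ¬ (let Λ : Set (EuclideanSpace ℝ (Fin 3)) := {z | ∃ i j k : ℤ, z = (i : ℝ) • triangularVec₁ 1 +
          (j : ℝ) • triangularVec₂ 1 + (k : ℝ) • layerNormal (2 * Real.sqrt (2 / 3))}
       let Near : Set (EuclideanSpace ℝ (Fin 3)) → EuclideanSpace ℝ (Fin 3) → ℝ →
          (Fin 2 → EuclideanSpace ℝ (Fin 3)) →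
          (EuclideanSpace ℝ (Fin 3) →L[ℝ] EuclideanSpace ℝ (Fin 3)) → ℝ → Prop :=
          fun X c r t A ε => (∀ p ∈ X, dist p c ≤ r → ∃ m : Fin 2, ∃ z ∈ Λ, dist p (t m + A z) ≤ ε) ∧
            (∀ m : Fin 2, ∀ z ∈ Λ, dist (t m + A z) c ≤ r → ∃ p ∈ X, dist p (t m + A z) ≤ ε)
       let Adm : (EuclideanSpace ℝ (Fin 3) →L[ℝ] EuclideanSpace ℝ (Fin 3)) → Prop := fun A =>
          ∃ R : EuclideanSpace ℝ (Fin 3) ≃ₗᵢ[ℝ] EuclideanSpace ℝ (Fin 3),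
            ‖A - (97 / 100 : ℝ) • (R.toContinuousLinearEquiv :
              EuclideanSpace ℝ (Fin 3) →L[ℝ] EuclideanSpace ℝ (Fin 3))‖ ≤ 1 / 40
       let Inner : (Fin 2 → EuclideanSpace ℝ (Fin 3)) →
          (EuclideanSpace ℝ (Fin 3) →L[ℝ] EuclideanSpace ℝ (Fin 3)) → Prop := fun t A =>
          ‖t 1 - t 0 - A (barlowOffset 1 + layerNormal (Real.sqrt (2 / 3)))‖ ≤ 1 / 40
       let Sites : (Fin 2 → EuclideanSpace ℝ (Fin 3)) →
          (EuclideanSpace ℝ (Fin 3) →L[ℝ] EuclideanSpace ℝ (Fin 3)) → Set (EuclideanSpace ℝ (Fin 3)) :=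
          fun t A => {p | ∃ m : Fin 2, ∃ z ∈ Λ, p = t m + A z}
       let Sep : Set (EuclideanSpace ℝ (Fin 3)) → ℝ → Prop := fun X δ =>
          ∀ p ∈ X, ∀ q ∈ X, p ≠ q → δ ≤ dist p q
       let Equil : Set (EuclideanSpace ℝ (Fin 3)) → Prop := fun X => ∀ p ∈ X,
          HasSum (fun q : {q : EuclideanSpace ℝ (Fin 3) // q ∈ X ∧ q ≠ p} =>
            (deriv lennardJones (dist p q.1) / dist p q.1) • (p - q.1)) 0
       ∀ δ : ℝ, 0 < δ → ∀ X : Set (EuclideanSpace ℝ (Fin 3)), Sep X δ → Equil X →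
         ∀ (t : Fin 2 → EuclideanSpace ℝ (Fin 3))
           (A : EuclideanSpace ℝ (Fin 3) →L[ℝ] EuclideanSpace ℝ (Fin 3)), Inner t A →
           (∀ (c : EuclideanSpace ℝ (Fin 3)) (r : ℝ), Near X c r t A (1 / 40)) →
           ∃ (t' : Fin 2 → EuclideanSpace ℝ (Fin 3))
             (A' : EuclideanSpace ℝ (Fin 3) →L[ℝ] EuclideanSpace ℝ (Fin 3)), Adm A' ∧ X = Sites t' A') := by
  intro h
  -- the period lattice and two of its vectors
  set Λ : Set (EuclideanSpace ℝ (Fin 3)) := {z | ∃ i j k : ℤ, z = (i : ℝ) • triangularVec₁ 1 +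
    (j : ℝ) • triangularVec₂ 1 + (k : ℝ) • layerNormal (2 * Real.sqrt (2 / 3))} with hΛ
  have h0Λ : (0 : EuclideanSpace ℝ (Fin 3)) ∈ Λ := ⟨0, 0, 0, by simp⟩
  set cv : EuclideanSpace ℝ (Fin 3) := layerNormal (2 * Real.sqrt (2 / 3)) with hcv
  have hcvΛ : cv ∈ Λ := ⟨0, 0, 1, by simp [cv]⟩
  have hcv0 : cv ≠ 0 := by
    intro hz
    have h2 := congrArg (fun v : EuclideanSpace ℝ (Fin 3) => v 2) hz
    simp [cv, layerNormal] at h2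
  -- hypotheses of `Core` for the witness
  have hInner : ‖(fun _ : Fin 2 => (0 : EuclideanSpace ℝ (Fin 3))) 1 - (fun _ => 0) 0 -
      (0 : EuclideanSpace ℝ (Fin 3) →L[ℝ] EuclideanSpace ℝ (Fin 3))
        (barlowOffset 1 + layerNormal (Real.sqrt (2 / 3)))‖ ≤ 1 / 40 := by
    norm_num
  have hSep : ∀ p ∈ ({0} : Set (EuclideanSpace ℝ (Fin 3))), ∀ q ∈ ({0} : Set (EuclideanSpace ℝ (Fin 3))),
      p ≠ q → (1 : ℝ) ≤ dist p q := by
    intro p hp q hq hne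
    rw [Set.mem_singleton_iff] at hp hq
    exact (hne (hp.trans hq.symm)).elim
  have hEquil : ∀ p ∈ ({0} : Set (EuclideanSpace ℝ (Fin 3))),
      HasSum (fun q : {q : EuclideanSpace ℝ (Fin 3) // q ∈ ({0} : Set (EuclideanSpace ℝ (Fin 3))) ∧ q ≠ p} =>
        (deriv lennardJones (dist p q.1) / dist p q.1) • (p - q.1)) 0 := by
    intro p hp
    rw [Set.mem_singleton_iff] at hp
    haveI : IsEmpty {q : EuclideanSpace ℝ (Fin 3) // q ∈ ({0} : Set (EuclideanSpace ℝ (Fin 3))) ∧ q ≠ p} :=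
      ⟨fun q => q.2.2 ((Set.mem_singleton_iff.mp q.2.1).trans hp.symm)⟩
    exact hasSum_empty
  have hNear : ∀ (c : EuclideanSpace ℝ (Fin 3)) (r : ℝ),
      (∀ p ∈ ({0} : Set (EuclideanSpace ℝ (Fin 3))), dist p c ≤ r → ∃ m : Fin 2, ∃ z ∈ Λ,
        dist p ((fun _ : Fin 2 => (0 : EuclideanSpace ℝ (Fin 3))) m +
          (0 : EuclideanSpace ℝ (Fin 3) →L[ℝ] EuclideanSpace ℝ (Fin 3)) z) ≤ 1 / 40) ∧
      (∀ m : Fin 2, ∀ z ∈ Λ, dist ((fun _ : Fin 2 => (0 : EuclideanSpace ℝ (Fin 3))) m +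
          (0 : EuclideanSpace ℝ (Fin 3) →L[ℝ] EuclideanSpace ℝ (Fin 3)) z) c ≤ r →
        ∃ p ∈ ({0} : Set (EuclideanSpace ℝ (Fin 3))), dist p ((fun _ : Fin 2 => (0 : EuclideanSpace ℝ (Fin 3))) m +
          (0 : EuclideanSpace ℝ (Fin 3) →L[ℝ] EuclideanSpace ℝ (Fin 3)) z) ≤ 1 / 40) := by
    intro c r
    constructor
    · intro p hp _
      rw [Set.mem_singleton_iff] at hp
      refine ⟨0, 0, h0Λ, ?_⟩
      simp [hp]
    · intro m z _ _
      refine ⟨0, rfl, ?_⟩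
      simp
  obtain ⟨t', A', ⟨R, hR⟩, hX⟩ := h 1 one_pos {0} hSep hEquil (fun _ => 0) 0 hInner hNear
  -- two points of the concluded two-lattice
  have h0 : t' 0 ∈ ({0} : Set (EuclideanSpace ℝ (Fin 3))) := by
    rw [hX]; exact ⟨0, 0, h0Λ, by simp⟩
  have h1 : t' 0 + A' cv ∈ ({0} : Set (EuclideanSpace ℝ (Fin 3))) := by
    rw [hX]; exact ⟨0, cv, hcvΛ, rfl⟩
  rw [Set.mem_singleton_iff] at h0 h1
  rw [h0, zero_add] at h1
  have hpos : 0 < ‖cv‖ := norm_pos_iff.mpr hcv0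
  have key : ‖(A' - (97 / 100 : ℝ) • (R.toContinuousLinearEquiv :
      EuclideanSpace ℝ (Fin 3) →L[ℝ] EuclideanSpace ℝ (Fin 3))) cv‖ ≤ 1 / 40 * ‖cv‖ :=
    (ContinuousLinearMap.le_opNorm _ _).trans (mul_le_mul_of_nonneg_right hR (norm_nonneg _))
  have heq : ‖(A' - (97 / 100 : ℝ) • (R.toContinuousLinearEquiv :
      EuclideanSpace ℝ (Fin 3) →L[ℝ] EuclideanSpace ℝ (Fin 3))) cv‖ = 97 / 100 * ‖cv‖ := by
    simp [h1, norm_smul]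
  rw [heq] at key
  nlinarith

end Summit.AtomisticToContinuum.Crystallization.Theorems
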